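import Summits.BirchSwinnertonDyer.Rank1Residual.GaloisImage.CongruenceVisibilityIdentityComponentIndex
import Literature.NumberTheory.EllipticCurves.CongruenceVisibilityComparison
import HarnessLib

/-!
# THEOREM B through the master count: visibility ENDs in the comparison-index currency
# (cell `b2b-bsdres`, team n1011, seat p10 GEN 9; ROW T-VIS3-UC-IOTA FILE 2;
# skeleton `cells/n1011/skel/T-VIS3-UC-IOTA.md`)

HONEST FRAMING (cell `b2b-bsdres`, run/shared/lean/b2b/bsd-rank1-residual/, verbatim in every
file): the goal of the cell is to DELETE the COMBINATION-SHAPED residual classes of the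
Birch–Swinnerton-Dyer formula for ALL analytic-rank `≤ 1` elliptic curves over `ℚ` — "full BSD
formula for every rank `≤ 1` curve in class `C`" assembled STRICTLY from published theorems — so
that the rank-`≤ 1` remainder becomes exactly the CONSTRUCTION-SHAPED classes, which are TYPED
(missing-input `Prop`s), NOT attempted. This is not "finishing BSD". Team n1011 (N10 / N11):
research route on the CONSTRUCTION-SHAPED class X4 (§I N11 LOWER half / O7); no claim beyond the
stated classes; nothing is booked; marks UNCHANGED. Theorems only: no definition, no named fact,
no `sorry`. RECORD-SHAPE theorems; they close nothing by themselves.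

## What

FILE 1b's `relIndex_map_selmerLocalKer_le_three_of_identityComponent` (`ι_{v₀}(θ) ≤ 3` on
σ = E0/E0) fed into the tree's master count
`WeierstrassCurve.exists_sha_ne_zero_of_congr_of_relIndex_lt`
(`[E(K):3E(K)] · ∏_{v ∈ S} ι_v(θ) < [E'(K):3E'(K)] ⇒ Ш(E/K)[3] ≠ 0`):

* `exists_sha_ne_zero_of_congr_of_identityComponent_of_index_lt` — 8b's record shape with the
  witness binders `(hfin hcop P₁ P₂ hind)` REPLACED by the budget
  `hbud : [E(K):3E(K)] · 3 < [E'(K):3E'(K)]` (the place `v₀` pays `3`, every other place of `S`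
  agrees along `θ`: `hoff`);
* `…_of_rank_two` — the rank-`0` receiver shape: `E(K)` finite of order prime to `3` and
  `2 ≤ rank E'(K)` (`3 < 9 ≤ [E'(K):3E'(K)]`); this is the K42 record shape with `hrank` displayed
  like every T-VIS3 record, instead of two explicit points and four non-divisibility certificates;
* `…_of_index_le_three` — the rank-`1` receiver shape: `[E(K):3E(K)] ≤ 3` (e.g. rank `1`,
  `E(K)[3] = 0`) and `3 ≤ rank E'(K)` (`9 < 27`);
* `…_of_prod_lt` — the general budget `[E(K):3E(K)] · 3 · ∏_{v ∈ S ∖ v₀} ι_v(θ) < [E'(K):3E'(K)]`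
  (other places may pay too, e.g. a rank-`3` partner with one more place of index `≤ 3`).
FILE 3 (`…IndexRat`): the `ℚ` wrappers at `primesEquiv v₀ = 3`.

A rank-`0` X4 row then reads `BSDp W 3` by ONE call of n1011-p14's kind-agnostic ENDs
`X4RankZero.bsdp_three_potMult_of_exists_sha_three_torsion` / `…bsdp_of_exists_sha_torsion_of_kato`;
the `hE0` form of the per-curve datum converts by 8c's `exists_identityComponent_torsion_of_card`.
References: [CremonaMazur2000] §3 and Table 1; [AgasheStein2002] Thm. 3.1, §3.5; [MazurRubin2004]
§2.3; [MilneADT2006] I.3.3, I.3.8; L41-NOTE §§1–2 (`HOME/b2b-bsdres-n1011-p10/g8/`). -/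

noncomputable section

open scoped Classical

namespace Summit.BirchSwinnertonDyer.Rank1Residual.GaloisImage.TwistedWitness

open WeierstrassCurve Literature.NumberTheory.EllipticCurves Literature.NumberTheory.GaloisRepresentations
open Field NumberField IsDedekindDomain IsDedekindDomain.HeightOneSpectrum

section General

variable {K : Type} [Field K] [NumberField K] (W W' : WeierstrassCurve K) [W.IsElliptic] [W'.IsElliptic]

/-- **THEOREM B with a general budget: `Ш(E/K)[3] ≠ 0` when
`[E(K):3E(K)] · 3 · ∏_{v ∈ S ∖ v₀} ι_v(θ) < [E'(K):3E'(K)]`.** `θ : E'[3] ⥲ E[3]` `Γ_K`-equivariant;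
`S` with both curves good and `v ∤ 3` outside; at `v₀ ∣ 3` the identity-component data of FILE 1b
(`ι_{v₀}(θ) ≤ 3`); the other places of `S` enter through their comparison indices (each `≥ 1`, the
free kinds give `1`). The master count `exists_sha_ne_zero_of_congr_of_relIndex_lt` concludes.
[cite: CremonaMazur2000, §3 pp. 19–22] [cite: AgasheStein2002, Thm. 3.1 and §3.5]
[cite: MilneADT2006, Ch. I Prop. 3.8 and Lemma 3.3] -/
theorem exists_sha_ne_zero_of_congr_of_identityComponent_of_prod_lt
    (θ : geomTorsion W' ((3 : ℕ) : ℤ) ≃+ geomTorsion W ((3 : ℕ) : ℤ))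
    (hθ : ∀ (σ : absoluteGaloisGroup K) (P : geomTorsion W' ((3 : ℕ) : ℤ)), θ (σ • P) = σ • θ P)
    (S : Finset (HeightOneSpectrum (𝓞 K)))
    (hS : ∀ v : HeightOneSpectrum (𝓞 K), v ∉ S →
      W.HasGoodReductionAt v ∧ W'.HasGoodReductionAt v ∧ ((3 : ℕ) : 𝓞 K) ∉ v.asIdeal)
    (v₀ : HeightOneSpectrum (𝓞 K)) (h3v : ((3 : ℕ) : 𝓞 K) ∈ v₀.asIdeal)
    (hbud : (zsmulAddGroupHom ((3 : ℕ) : ℤ) : W.toAffine.Point →+ W.toAffine.Point).range.index *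
      (3 * ∏ v ∈ S.erase v₀, (selmerLocalKer W (v.adicCompletion K) ((3 : ℕ) : ℤ)).relIndex
        ((selmerLocalKer W' (v.adicCompletion K) ((3 : ℕ) : ℤ)).map (h1Equiv θ hθ).toAddMonoidHom)) <
      (zsmulAddGroupHom ((3 : ℕ) : ℤ) : W'.toAffine.Point →+ W'.toAffine.Point).range.index)
    (hO3 : Nat.card (v₀.adicCompletionIntegers K ⧸
      Ideal.span {((3 : ℕ) : v₀.adicCompletionIntegers K)}) = 3)
    {δ : v₀.adicCompletion K} (hδ : δ ^ 2 = -23)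
    (hnoroot : ∀ x : v₀.adicCompletion K, x ^ 3 - x - 1 ≠ 0)
    (hn3 : ∀ y : v₀.adicCompletion K, y ^ 2 ≠ -3)
    (hcard : Nat.card (nsmulAddMonoidHom 3 :
      (W.baseChange (v₀.adicCompletion K)).toAffine.Point →+ _).ker = 3)
    (hcard' : Nat.card (nsmulAddMonoidHom 3 :
      (W'.baseChange (v₀.adicCompletion K)).toAffine.Point →+ _).ker = 3)
    (M : WeierstrassCurve (v₀.adicCompletionIntegers K)) (C : VariableChange (v₀.adicCompletion K))
    (hC : C • W.baseChange (v₀.adicCompletion K) =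
      M.map (algebraMap (v₀.adicCompletionIntegers K) (v₀.adicCompletion K)))
    (x₀ y₀ a : IsLocalRing.ResidueField (v₀.adicCompletionIntegers K))
    (hcusp : M.map (IsLocalRing.residue (v₀.adicCompletionIntegers K)) = singularModel x₀ y₀ a a)
    {a₀ b₀ : v₀.adicCompletionIntegers K}
    (hns₀ : (M.map (IsLocalRing.residue (v₀.adicCompletionIntegers K))).toAffine.Nonsingular
      (IsLocalRing.residue (v₀.adicCompletionIntegers K) a₀)
      (IsLocalRing.residue (v₀.adicCompletionIntegers K) b₀))
    (hm : ((M.map (algebraMap (v₀.adicCompletionIntegers K) (v₀.adicCompletion K))).baseChange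
        (AlgebraicClosure (v₀.adicCompletion K))).toAffine.Nonsingular
      (algebraMap (v₀.adicCompletionIntegers K) (AlgebraicClosure (v₀.adicCompletion K)) a₀)
      (algebraMap (v₀.adicCompletionIntegers K) (AlgebraicClosure (v₀.adicCompletion K)) b₀))
    (h3 : (3 : ℤ) • (Affine.Point.some _ _ hm :
      ((M.map (algebraMap (v₀.adicCompletionIntegers K) (v₀.adicCompletion K))).baseChange
        (AlgebraicClosure (v₀.adicCompletion K))).toAffine.Point) = 0)
    (M' : WeierstrassCurve (v₀.adicCompletionIntegers K)) (C' : VariableChange (v₀.adicCompletion K))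
    (hC' : C' • W'.baseChange (v₀.adicCompletion K) =
      M'.map (algebraMap (v₀.adicCompletionIntegers K) (v₀.adicCompletion K)))
    (x₀' y₀' a' : IsLocalRing.ResidueField (v₀.adicCompletionIntegers K))
    (hcusp' : M'.map (IsLocalRing.residue (v₀.adicCompletionIntegers K)) = singularModel x₀' y₀' a' a')
    {a₀' b₀' : v₀.adicCompletionIntegers K}
    (hns₀' : (M'.map (IsLocalRing.residue (v₀.adicCompletionIntegers K))).toAffine.Nonsingular
      (IsLocalRing.residue (v₀.adicCompletionIntegers K) a₀')
      (IsLocalRing.residue (v₀.adicCompletionIntegers K) b₀'))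
    (hm' : ((M'.map (algebraMap (v₀.adicCompletionIntegers K) (v₀.adicCompletion K))).baseChange
        (AlgebraicClosure (v₀.adicCompletion K))).toAffine.Nonsingular
      (algebraMap (v₀.adicCompletionIntegers K) (AlgebraicClosure (v₀.adicCompletion K)) a₀')
      (algebraMap (v₀.adicCompletionIntegers K) (AlgebraicClosure (v₀.adicCompletion K)) b₀'))
    (h3' : (3 : ℤ) • (Affine.Point.some _ _ hm' :
      ((M'.map (algebraMap (v₀.adicCompletionIntegers K) (v₀.adicCompletion K))).baseChange
        (AlgebraicClosure (v₀.adicCompletion K))).toAffine.Point) = 0) :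
    ∃ c : W.sha, c ≠ 0 ∧ 3 • c = 0 := by
  haveI : Fact (Nat.Prime 3) := ⟨Nat.prime_three⟩
  have hv₀S : v₀ ∈ S := by
    by_contra h
    exact (hS v₀ h).2.2 h3v
  have hι := relIndex_map_selmerLocalKer_le_three_of_identityComponent W W' θ hθ v₀ h3v hO3 hδ hnoroot
    hn3 hcard hcard' M C hC x₀ y₀ a hcusp hns₀ hm h3 M' C' hC' x₀' y₀' a' hcusp' hns₀' hm' h3'
  refine W.exists_sha_ne_zero_of_congr_of_relIndex_lt W' (p := 3) (by norm_num) θ hθ S hS ?_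
  rw [← Finset.mul_prod_erase S _ hv₀S]
  exact lt_of_le_of_lt (Nat.mul_le_mul_left _ (Nat.mul_le_mul_right _ hι)) hbud

/-- **THEOREM B with a budget: `Ш(E/K)[3] ≠ 0` when `[E(K):3E(K)] · 3 < [E'(K):3E'(K)]`** and the
local conditions agree along `θ` at every `v ∈ S`, `v ≠ v₀` (`ι_v(θ) = 1`: 8b's `hoff`, the free
kinds); at `v₀ ∣ 3` the identity-component data of FILE 1b (`ι_{v₀}(θ) ≤ 3`).
[cite: CremonaMazur2000, §3 pp. 19–22] [cite: AgasheStein2002, Thm. 3.1 and §3.5]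
[cite: MilneADT2006, Ch. I Prop. 3.8 and Lemma 3.3] -/
theorem exists_sha_ne_zero_of_congr_of_identityComponent_of_index_lt
    (θ : geomTorsion W' ((3 : ℕ) : ℤ) ≃+ geomTorsion W ((3 : ℕ) : ℤ))
    (hθ : ∀ (σ : absoluteGaloisGroup K) (P : geomTorsion W' ((3 : ℕ) : ℤ)), θ (σ • P) = σ • θ P)
    (S : Finset (HeightOneSpectrum (𝓞 K)))
    (hS : ∀ v : HeightOneSpectrum (𝓞 K), v ∉ S →
      W.HasGoodReductionAt v ∧ W'.HasGoodReductionAt v ∧ ((3 : ℕ) : 𝓞 K) ∉ v.asIdeal)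
    (hbud : (zsmulAddGroupHom ((3 : ℕ) : ℤ) : W.toAffine.Point →+ W.toAffine.Point).range.index * 3 <
      (zsmulAddGroupHom ((3 : ℕ) : ℤ) : W'.toAffine.Point →+ W'.toAffine.Point).range.index)
    (v₀ : HeightOneSpectrum (𝓞 K)) (h3v : ((3 : ℕ) : 𝓞 K) ∈ v₀.asIdeal)
    (hO3 : Nat.card (v₀.adicCompletionIntegers K ⧸
      Ideal.span {((3 : ℕ) : v₀.adicCompletionIntegers K)}) = 3)
    {δ : v₀.adicCompletion K} (hδ : δ ^ 2 = -23)
    (hnoroot : ∀ x : v₀.adicCompletion K, x ^ 3 - x - 1 ≠ 0)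
    (hn3 : ∀ y : v₀.adicCompletion K, y ^ 2 ≠ -3)
    (hoff : ∀ v ∈ S, v ≠ v₀ →
      (selmerLocalKer W (v.adicCompletion K) ((3 : ℕ) : ℤ)).relIndex
        ((selmerLocalKer W' (v.adicCompletion K) ((3 : ℕ) : ℤ)).map (h1Equiv θ hθ).toAddMonoidHom) = 1)
    (hcard : Nat.card (nsmulAddMonoidHom 3 :
      (W.baseChange (v₀.adicCompletion K)).toAffine.Point →+ _).ker = 3)
    (hcard' : Nat.card (nsmulAddMonoidHom 3 :
      (W'.baseChange (v₀.adicCompletion K)).toAffine.Point →+ _).ker = 3)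
    (M : WeierstrassCurve (v₀.adicCompletionIntegers K)) (C : VariableChange (v₀.adicCompletion K))
    (hC : C • W.baseChange (v₀.adicCompletion K) =
      M.map (algebraMap (v₀.adicCompletionIntegers K) (v₀.adicCompletion K)))
    (x₀ y₀ a : IsLocalRing.ResidueField (v₀.adicCompletionIntegers K))
    (hcusp : M.map (IsLocalRing.residue (v₀.adicCompletionIntegers K)) = singularModel x₀ y₀ a a)
    {a₀ b₀ : v₀.adicCompletionIntegers K}
    (hns₀ : (M.map (IsLocalRing.residue (v₀.adicCompletionIntegers K))).toAffine.Nonsingular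
      (IsLocalRing.residue (v₀.adicCompletionIntegers K) a₀)
      (IsLocalRing.residue (v₀.adicCompletionIntegers K) b₀))
    (hm : ((M.map (algebraMap (v₀.adicCompletionIntegers K) (v₀.adicCompletion K))).baseChange
        (AlgebraicClosure (v₀.adicCompletion K))).toAffine.Nonsingular
      (algebraMap (v₀.adicCompletionIntegers K) (AlgebraicClosure (v₀.adicCompletion K)) a₀)
      (algebraMap (v₀.adicCompletionIntegers K) (AlgebraicClosure (v₀.adicCompletion K)) b₀))
    (h3 : (3 : ℤ) • (Affine.Point.some _ _ hm :
      ((M.map (algebraMap (v₀.adicCompletionIntegers K) (v₀.adicCompletion K))).baseChange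
        (AlgebraicClosure (v₀.adicCompletion K))).toAffine.Point) = 0)
    (M' : WeierstrassCurve (v₀.adicCompletionIntegers K)) (C' : VariableChange (v₀.adicCompletion K))
    (hC' : C' • W'.baseChange (v₀.adicCompletion K) =
      M'.map (algebraMap (v₀.adicCompletionIntegers K) (v₀.adicCompletion K)))
    (x₀' y₀' a' : IsLocalRing.ResidueField (v₀.adicCompletionIntegers K))
    (hcusp' : M'.map (IsLocalRing.residue (v₀.adicCompletionIntegers K)) = singularModel x₀' y₀' a' a')
    {a₀' b₀' : v₀.adicCompletionIntegers K}
    (hns₀' : (M'.map (IsLocalRing.residue (v₀.adicCompletionIntegers K))).toAffine.Nonsingular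
      (IsLocalRing.residue (v₀.adicCompletionIntegers K) a₀')
      (IsLocalRing.residue (v₀.adicCompletionIntegers K) b₀'))
    (hm' : ((M'.map (algebraMap (v₀.adicCompletionIntegers K) (v₀.adicCompletion K))).baseChange
        (AlgebraicClosure (v₀.adicCompletion K))).toAffine.Nonsingular
      (algebraMap (v₀.adicCompletionIntegers K) (AlgebraicClosure (v₀.adicCompletion K)) a₀')
      (algebraMap (v₀.adicCompletionIntegers K) (AlgebraicClosure (v₀.adicCompletion K)) b₀'))
    (h3' : (3 : ℤ) • (Affine.Point.some _ _ hm' :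
      ((M'.map (algebraMap (v₀.adicCompletionIntegers K) (v₀.adicCompletion K))).baseChange
        (AlgebraicClosure (v₀.adicCompletion K))).toAffine.Point) = 0) :
    ∃ c : W.sha, c ≠ 0 ∧ 3 • c = 0 := by
  refine exists_sha_ne_zero_of_congr_of_identityComponent_of_prod_lt W W' θ hθ S hS v₀ h3v ?_ hO3 hδ
    hnoroot hn3 hcard hcard' M C hC x₀ y₀ a hcusp hns₀ hm h3 M' C' hC' x₀' y₀' a' hcusp' hns₀' hm' h3'
  rwa [Finset.prod_eq_one (fun v hv ↦ hoff v (Finset.mem_of_mem_erase hv) (Finset.ne_of_mem_erase hv)),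
    mul_one]

/-- **The rank-`0` receiver shape (K42 road): `E(K)` finite of order prime to `3`, a `3`-congruent
`E'` of rank `≥ 2`, σ = E0/E0 at `v₀ ∣ 3`, agreement elsewhere ⇒ `Ш(E/K)[3] ≠ 0`.**
(`[E(K):3E(K)] = 1`, `9 ≤ 3^{rank E'} ≤ [E'(K):3E'(K)]`.) The binder `hrank` replaces 8b's
`P₁ P₂ hind`. [cite: CremonaMazur2000, §3 and Table 1] [cite: AgasheStein2002, Thm. 3.1]
[cite: MilneADT2006, Ch. I Prop. 3.8 and Lemma 3.3] -/
theorem exists_sha_ne_zero_of_congr_of_identityComponent_of_rank_two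
    (θ : geomTorsion W' ((3 : ℕ) : ℤ) ≃+ geomTorsion W ((3 : ℕ) : ℤ))
    (hθ : ∀ (σ : absoluteGaloisGroup K) (P : geomTorsion W' ((3 : ℕ) : ℤ)), θ (σ • P) = σ • θ P)
    (S : Finset (HeightOneSpectrum (𝓞 K)))
    (hS : ∀ v : HeightOneSpectrum (𝓞 K), v ∉ S →
      W.HasGoodReductionAt v ∧ W'.HasGoodReductionAt v ∧ ((3 : ℕ) : 𝓞 K) ∉ v.asIdeal)
    (hfin : Finite W.toAffine.Point) (hcop : (Nat.card W.toAffine.Point).Coprime 3)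
    (hrank : 2 ≤ W'.mordellWeilRank)
    (v₀ : HeightOneSpectrum (𝓞 K)) (h3v : ((3 : ℕ) : 𝓞 K) ∈ v₀.asIdeal)
    (hO3 : Nat.card (v₀.adicCompletionIntegers K ⧸
      Ideal.span {((3 : ℕ) : v₀.adicCompletionIntegers K)}) = 3)
    {δ : v₀.adicCompletion K} (hδ : δ ^ 2 = -23)
    (hnoroot : ∀ x : v₀.adicCompletion K, x ^ 3 - x - 1 ≠ 0)
    (hn3 : ∀ y : v₀.adicCompletion K, y ^ 2 ≠ -3)
    (hoff : ∀ v ∈ S, v ≠ v₀ →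
      (selmerLocalKer W (v.adicCompletion K) ((3 : ℕ) : ℤ)).relIndex
        ((selmerLocalKer W' (v.adicCompletion K) ((3 : ℕ) : ℤ)).map (h1Equiv θ hθ).toAddMonoidHom) = 1)
    (hcard : Nat.card (nsmulAddMonoidHom 3 :
      (W.baseChange (v₀.adicCompletion K)).toAffine.Point →+ _).ker = 3)
    (hcard' : Nat.card (nsmulAddMonoidHom 3 :
      (W'.baseChange (v₀.adicCompletion K)).toAffine.Point →+ _).ker = 3)
    (M : WeierstrassCurve (v₀.adicCompletionIntegers K)) (C : VariableChange (v₀.adicCompletion K))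
    (hC : C • W.baseChange (v₀.adicCompletion K) =
      M.map (algebraMap (v₀.adicCompletionIntegers K) (v₀.adicCompletion K)))
    (x₀ y₀ a : IsLocalRing.ResidueField (v₀.adicCompletionIntegers K))
    (hcusp : M.map (IsLocalRing.residue (v₀.adicCompletionIntegers K)) = singularModel x₀ y₀ a a)
    {a₀ b₀ : v₀.adicCompletionIntegers K}
    (hns₀ : (M.map (IsLocalRing.residue (v₀.adicCompletionIntegers K))).toAffine.Nonsingular
      (IsLocalRing.residue (v₀.adicCompletionIntegers K) a₀)
      (IsLocalRing.residue (v₀.adicCompletionIntegers K) b₀))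
    (hm : ((M.map (algebraMap (v₀.adicCompletionIntegers K) (v₀.adicCompletion K))).baseChange
        (AlgebraicClosure (v₀.adicCompletion K))).toAffine.Nonsingular
      (algebraMap (v₀.adicCompletionIntegers K) (AlgebraicClosure (v₀.adicCompletion K)) a₀)
      (algebraMap (v₀.adicCompletionIntegers K) (AlgebraicClosure (v₀.adicCompletion K)) b₀))
    (h3 : (3 : ℤ) • (Affine.Point.some _ _ hm :
      ((M.map (algebraMap (v₀.adicCompletionIntegers K) (v₀.adicCompletion K))).baseChange
        (AlgebraicClosure (v₀.adicCompletion K))).toAffine.Point) = 0)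
    (M' : WeierstrassCurve (v₀.adicCompletionIntegers K)) (C' : VariableChange (v₀.adicCompletion K))
    (hC' : C' • W'.baseChange (v₀.adicCompletion K) =
      M'.map (algebraMap (v₀.adicCompletionIntegers K) (v₀.adicCompletion K)))
    (x₀' y₀' a' : IsLocalRing.ResidueField (v₀.adicCompletionIntegers K))
    (hcusp' : M'.map (IsLocalRing.residue (v₀.adicCompletionIntegers K)) = singularModel x₀' y₀' a' a')
    {a₀' b₀' : v₀.adicCompletionIntegers K}
    (hns₀' : (M'.map (IsLocalRing.residue (v₀.adicCompletionIntegers K))).toAffine.Nonsingular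
      (IsLocalRing.residue (v₀.adicCompletionIntegers K) a₀')
      (IsLocalRing.residue (v₀.adicCompletionIntegers K) b₀'))
    (hm' : ((M'.map (algebraMap (v₀.adicCompletionIntegers K) (v₀.adicCompletion K))).baseChange
        (AlgebraicClosure (v₀.adicCompletion K))).toAffine.Nonsingular
      (algebraMap (v₀.adicCompletionIntegers K) (AlgebraicClosure (v₀.adicCompletion K)) a₀')
      (algebraMap (v₀.adicCompletionIntegers K) (AlgebraicClosure (v₀.adicCompletion K)) b₀'))
    (h3' : (3 : ℤ) • (Affine.Point.some _ _ hm' :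
      ((M'.map (algebraMap (v₀.adicCompletionIntegers K) (v₀.adicCompletion K))).baseChange
        (AlgebraicClosure (v₀.adicCompletion K))).toAffine.Point) = 0) :
    ∃ c : W.sha, c ≠ 0 ∧ 3 • c = 0 := by
  haveI : Fact (Nat.Prime 3) := ⟨Nat.prime_three⟩
  haveI := hfin
  refine exists_sha_ne_zero_of_congr_of_identityComponent_of_index_lt W W' θ hθ S hS ?_ v₀ h3v hO3 hδ
    hnoroot hn3 hoff hcard hcard' M C hC x₀ y₀ a hcusp hns₀ hm h3 M' C' hC' x₀' y₀' a' hcusp' hns₀' hm' h3'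
  rw [index_range_zsmul_eq_one_of_coprime hcop, one_mul]
  calc 3 < 3 ^ 2 := by norm_num
    _ ≤ 3 ^ W'.mordellWeilRank := Nat.pow_le_pow_right (by norm_num) hrank
    _ ≤ _ := pow_mordellWeilRank_le_index_range_zsmul W' (by norm_num)

/-- **The rank-`1` receiver shape: `[E(K):3E(K)] ≤ 3` (e.g. rank `1` and `E(K)[3] = 0`), a
`3`-congruent `E'` of rank `≥ 3`, σ = E0/E0 at `v₀ ∣ 3`, agreement elsewhere ⇒ `Ш(E/K)[3] ≠ 0`**
(`3 · 3 = 9 < 27 ≤ 3^{rank E'} ≤ [E'(K):3E'(K)]`). The O7 (analytic rank `1`) E0/E0 rows with a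
rank-`3` partner. [cite: CremonaMazur2000, §3 and Table 1] [cite: AgasheStein2002, Thm. 3.1 and §3.5]
[cite: MilneADT2006, Ch. I Prop. 3.8 and Lemma 3.3] -/
theorem exists_sha_ne_zero_of_congr_of_identityComponent_of_index_le_three
    (θ : geomTorsion W' ((3 : ℕ) : ℤ) ≃+ geomTorsion W ((3 : ℕ) : ℤ))
    (hθ : ∀ (σ : absoluteGaloisGroup K) (P : geomTorsion W' ((3 : ℕ) : ℤ)), θ (σ • P) = σ • θ P)
    (S : Finset (HeightOneSpectrum (𝓞 K)))
    (hS : ∀ v : HeightOneSpectrum (𝓞 K), v ∉ S →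
      W.HasGoodReductionAt v ∧ W'.HasGoodReductionAt v ∧ ((3 : ℕ) : 𝓞 K) ∉ v.asIdeal)
    (hidxE : (zsmulAddGroupHom ((3 : ℕ) : ℤ) : W.toAffine.Point →+ W.toAffine.Point).range.index ≤ 3)
    (hrank : 3 ≤ W'.mordellWeilRank)
    (v₀ : HeightOneSpectrum (𝓞 K)) (h3v : ((3 : ℕ) : 𝓞 K) ∈ v₀.asIdeal)
    (hO3 : Nat.card (v₀.adicCompletionIntegers K ⧸
      Ideal.span {((3 : ℕ) : v₀.adicCompletionIntegers K)}) = 3)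
    {δ : v₀.adicCompletion K} (hδ : δ ^ 2 = -23)
    (hnoroot : ∀ x : v₀.adicCompletion K, x ^ 3 - x - 1 ≠ 0)
    (hn3 : ∀ y : v₀.adicCompletion K, y ^ 2 ≠ -3)
    (hoff : ∀ v ∈ S, v ≠ v₀ →
      (selmerLocalKer W (v.adicCompletion K) ((3 : ℕ) : ℤ)).relIndex
        ((selmerLocalKer W' (v.adicCompletion K) ((3 : ℕ) : ℤ)).map (h1Equiv θ hθ).toAddMonoidHom) = 1)
    (hcard : Nat.card (nsmulAddMonoidHom 3 :
      (W.baseChange (v₀.adicCompletion K)).toAffine.Point →+ _).ker = 3)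
    (hcard' : Nat.card (nsmulAddMonoidHom 3 :
      (W'.baseChange (v₀.adicCompletion K)).toAffine.Point →+ _).ker = 3)
    (M : WeierstrassCurve (v₀.adicCompletionIntegers K)) (C : VariableChange (v₀.adicCompletion K))
    (hC : C • W.baseChange (v₀.adicCompletion K) =
      M.map (algebraMap (v₀.adicCompletionIntegers K) (v₀.adicCompletion K)))
    (x₀ y₀ a : IsLocalRing.ResidueField (v₀.adicCompletionIntegers K))
    (hcusp : M.map (IsLocalRing.residue (v₀.adicCompletionIntegers K)) = singularModel x₀ y₀ a a)
    {a₀ b₀ : v₀.adicCompletionIntegers K}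
    (hns₀ : (M.map (IsLocalRing.residue (v₀.adicCompletionIntegers K))).toAffine.Nonsingular
      (IsLocalRing.residue (v₀.adicCompletionIntegers K) a₀)
      (IsLocalRing.residue (v₀.adicCompletionIntegers K) b₀))
    (hm : ((M.map (algebraMap (v₀.adicCompletionIntegers K) (v₀.adicCompletion K))).baseChange
        (AlgebraicClosure (v₀.adicCompletion K))).toAffine.Nonsingular
      (algebraMap (v₀.adicCompletionIntegers K) (AlgebraicClosure (v₀.adicCompletion K)) a₀)
      (algebraMap (v₀.adicCompletionIntegers K) (AlgebraicClosure (v₀.adicCompletion K)) b₀))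
    (h3 : (3 : ℤ) • (Affine.Point.some _ _ hm :
      ((M.map (algebraMap (v₀.adicCompletionIntegers K) (v₀.adicCompletion K))).baseChange
        (AlgebraicClosure (v₀.adicCompletion K))).toAffine.Point) = 0)
    (M' : WeierstrassCurve (v₀.adicCompletionIntegers K)) (C' : VariableChange (v₀.adicCompletion K))
    (hC' : C' • W'.baseChange (v₀.adicCompletion K) =
      M'.map (algebraMap (v₀.adicCompletionIntegers K) (v₀.adicCompletion K)))
    (x₀' y₀' a' : IsLocalRing.ResidueField (v₀.adicCompletionIntegers K))
    (hcusp' : M'.map (IsLocalRing.residue (v₀.adicCompletionIntegers K)) = singularModel x₀' y₀' a' a')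
    {a₀' b₀' : v₀.adicCompletionIntegers K}
    (hns₀' : (M'.map (IsLocalRing.residue (v₀.adicCompletionIntegers K))).toAffine.Nonsingular
      (IsLocalRing.residue (v₀.adicCompletionIntegers K) a₀')
      (IsLocalRing.residue (v₀.adicCompletionIntegers K) b₀'))
    (hm' : ((M'.map (algebraMap (v₀.adicCompletionIntegers K) (v₀.adicCompletion K))).baseChange
        (AlgebraicClosure (v₀.adicCompletion K))).toAffine.Nonsingular
      (algebraMap (v₀.adicCompletionIntegers K) (AlgebraicClosure (v₀.adicCompletion K)) a₀')
      (algebraMap (v₀.adicCompletionIntegers K) (AlgebraicClosure (v₀.adicCompletion K)) b₀'))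
    (h3' : (3 : ℤ) • (Affine.Point.some _ _ hm' :
      ((M'.map (algebraMap (v₀.adicCompletionIntegers K) (v₀.adicCompletion K))).baseChange
        (AlgebraicClosure (v₀.adicCompletion K))).toAffine.Point) = 0) :
    ∃ c : W.sha, c ≠ 0 ∧ 3 • c = 0 := by
  haveI : Fact (Nat.Prime 3) := ⟨Nat.prime_three⟩
  refine exists_sha_ne_zero_of_congr_of_identityComponent_of_index_lt W W' θ hθ S hS ?_ v₀ h3v hO3 hδ
    hnoroot hn3 hoff hcard hcard' M C hC x₀ y₀ a hcusp hns₀ hm h3 M' C' hC' x₀' y₀' a' hcusp' hns₀' hm' h3'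
  calc _ ≤ 3 * 3 := Nat.mul_le_mul_right 3 hidxE
    _ < 3 ^ 3 := by norm_num
    _ ≤ 3 ^ W'.mordellWeilRank := Nat.pow_le_pow_right (by norm_num) hrank
    _ ≤ _ := pow_mordellWeilRank_le_index_range_zsmul W' (by norm_num)

end General



end Summit.BirchSwinnertonDyer.Rank1Residual.GaloisImage.TwistedWitness

end
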